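import Literature.Computability.Complexity.LazySampling
import Literature.Computability.Complexity.ListFoldBricks
import Literature.Computability.Complexity.FPStringBricks
import HarnessLib

/-!
# The lazy-sampling answer oracle is a polynomial-time string function

Toolkit for Bennett–Gill's coin-flip simulator (`LazySamplingMachine.lean`, discharging
`Literature.Computability.Complexity.almostP_subset_BPP`). The simulator runs the oracle machine `M`
(reading first symbols only, `TrimAnswers.lean`) and announces, with each query `u`, its input
`w = ⟨x, y⟩` and its whole transcript `E` of earlier oracle answers (`OracleAlg.mapQuery`): the
query record is `v = ⟨w, ⟨code E, u⟩⟩`, `code E = ⟨1^{|E|}, ⟨e₀, … ⟨e_{|E|-1}, ε⟩…⟩⟩`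
(`Encoding.listBool`). Its queries are answered by the **lazy oracle** `lazyOracle F τ`, a plain
`FP` string function assembled in the brick algebra (`BrickAlgebra.lean`, `ListFoldBricks.lean`,
`FPStringBricks.lean`, `StringEquality.lean`, `BranchingFn.lean` — no machine is programmed):

* the answer is `bit :: u` (the query is *echoed* after the answer bit, so that the items
  `eᵢ = cᵢ :: uᵢ` of the transcript carry the history of queries);
* `bit` is the hard-wired table `τ` on `u ∈ F` (`tableF`: a chain of string-equality tests
  `eqPairFn` against the constants of `F`); otherwise the cached answer `cᵢ` of the first item with
  `uᵢ = u` (`scanF`: the fold `foldFn` of a comparison step over the items of the body of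
  `code E`, `firstHit`); otherwise the fresh coin `y[|E|]` (`coinF`: `bitAtFn` at the unary
  position `1^{|E|}`, the header of `code E`).

Main statements: `lazyOracle_mem_FP`, the value `lazyOracle_apply` on query records
(`= lazyBit F τ y E u :: u`), and the size bound `length_lazyOracle_le` (`≤ |u| + 1`). That
`lazyBit` on the echo transcript is the lazy-sampling rule `OracleAlg.coinAns` is proved in
`LazySamplingMachine.lean`.

## References

* C. H. Bennett, J. Gill, SIAM J. Comput. 10 (1981) 96–113 [BennettGill1981].
* R. V. Book, H. Vollmer, K. W. Wagner, ICALP 1996, LNCS 1099 [BookVollmerWagner1996], §3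
  Prop. 1–2 (p. 373–374): `BP²P` as a classical operator over coin words.
* S. Arora, B. Barak, *Computational Complexity: A Modern Approach*, CUP 2009, §1.3.
-/
namespace Literature.Computability.Complexity

open _root_.Computability Brick

namespace LazySim

/-! ### Field accessors on query records `v = ⟨w, ⟨H, u⟩⟩`, `w = ⟨x, y⟩`, `H = ⟨hdr, body⟩` -/

/-- The query `u` of a query record `⟨w, ⟨H, u⟩⟩`. [folklore] -/
noncomputable def uF : List Bool → List Bool := sndPow 1
/-- The coins: the second component of the input field `w`. [folklore] -/
noncomputable def yF : List Bool → List Bool := sndF ∘ nthF 0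
/-- The unary header `1^{|E|}` of the coded transcript. [folklore] -/
noncomputable def hdrF : List Bool → List Bool := fstF ∘ nthF 1
/-- The body of the coded transcript (the right-nested pairs of the earlier answers). [folklore] -/
noncomputable def bodyF : List Bool → List Bool := sndF ∘ nthF 1

/-- `uF` on a record. [folklore] -/
@[simp] theorem uF_apply (w H u : List Bool) : uF (boolPair w (boolPair H u)) = u := by simp [uF]
/-- `yF` on a record. [folklore] -/
@[simp] theorem yF_apply (w r : List Bool) : yF (boolPair w r) = sndF w := by simp [yF]
/-- `hdrF` on a record. [folklore] -/
@[simp] theorem hdrF_apply (w hdr body u : List Bool) :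
    hdrF (boolPair w (boolPair (boolPair hdr body) u)) = hdr := by simp [hdrF]
/-- `bodyF` on a record. [folklore] -/
@[simp] theorem bodyF_apply (w hdr body u : List Bool) :
    bodyF (boolPair w (boolPair (boolPair hdr body) u)) = body := by simp [bodyF]

/-- `uF ∈ FP`. [folklore] -/
theorem uF_mem_FP : uF ∈ FP := sndPow_mem_FP 1
/-- `yF ∈ FP`. [folklore] -/
theorem yF_mem_FP : yF ∈ FP := comp_mem_FP sndF_mem_FP (nthF_mem_FP 0)
/-- `hdrF ∈ FP`. [folklore] -/
theorem hdrF_mem_FP : hdrF ∈ FP := comp_mem_FP fstF_mem_FP (nthF_mem_FP 1)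
/-- `bodyF ∈ FP`. [folklore] -/
theorem bodyF_mem_FP : bodyF ∈ FP := comp_mem_FP sndF_mem_FP (nthF_mem_FP 1)

/-! ### One-bit conditions -/

/-- The equality test is one-bit on every input. [folklore] -/
theorem oneBit_eqPairFn : OneBit eqPairFn := fun w => by
  rcases eqPairFn_eq_or w with h | h <;> exact ⟨_, h⟩

/-! ### The coin -/

/-- The raw coin `(y.drop |hdr|).take 1` (positional bit access `bitAtFn`). [folklore] -/
noncomputable def rawCoinF : List Bool → List Bool := bitAtFn ∘ fanoutFn hdrF yF

/-- The coin as a one-symbol word `[y.getD |hdr| false]`. [folklore] -/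
noncomputable def coinF : List Bool → List Bool := iteFn (isNilFn ∘ rawCoinF) (fun _ => [false]) rawCoinF

/-- `rawCoinF ∈ FP`. [folklore] -/
theorem rawCoinF_mem_FP : rawCoinF ∈ FP := comp_mem_FP bitAtFn_mem_FP (fanoutFn_mem_FP hdrF_mem_FP yF_mem_FP)
/-- `coinF ∈ FP`. [folklore] -/
theorem coinF_mem_FP : coinF ∈ FP :=
  iteFn_mem_FP (comp_mem_FP isNilFn_mem_FP rawCoinF_mem_FP) (const_mem_FP _) rawCoinF_mem_FP

/-- **Value of the coin** on query records. [folklore] -/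
theorem coinF_apply (w hdr body u : List Bool) :
    coinF (boolPair w (boolPair (boolPair hdr body) u)) = [(sndF w).getD hdr.length false] := by
  set y := sndF w with hy
  have hraw : rawCoinF (boolPair w (boolPair (boolPair hdr body) u)) = (y.drop hdr.length).take 1 := by
    simp [rawCoinF, hy]
  unfold coinF
  by_cases hlt : hdr.length < y.length
  · have h1 : (y.drop hdr.length).take 1 = [y[hdr.length]] := by
      rw [List.take_one_drop_eq_of_lt_length hlt]; rfl
    rw [iteFn_apply_false (by simp [Function.comp_apply, hraw, h1, isNilFn]), hraw, h1]
    simp [List.getD_eq_getElem?_getD, List.getElem?_eq_getElem hlt]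
  · push Not at hlt
    have h1 : (y.drop hdr.length).take 1 = [] := by simp [List.drop_eq_nil_of_le hlt]
    rw [iteFn_apply_true (by simp [Function.comp_apply, hraw, h1, isNilFn])]
    simp [List.getD_eq_getElem?_getD, List.getElem?_eq_none (by simpa using hlt)]

/-- The coin is at most one symbol, on every input. [folklore] -/
theorem coinF_length (v : List Bool) : (coinF v).length ≤ 1 := by
  unfold coinF
  rw [iteFn_of_oneBit (oneBit_isNilFn.comp _)]
  split_ifs with h
  · simp
  · have : (rawCoinF v).length ≤ 1 := by
      simp only [rawCoinF, Function.comp_apply, fanoutFn_apply, bitAtFn_boolPair]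
      exact (List.length_take_le _ _)
    exact this

/-! ### The cache scan: a fold over the items of the body -/

/-- The scan step on fold records `⟨v', ⟨item, acc⟩⟩` (`v' = ⟨v, body⟩`): keep a found answer;
otherwise, if `tail item = u`, record `item ↾ 1`. [folklore] -/
noncomputable def scanStep : List Bool → List Bool :=
  iteFn (isNilFn ∘ sndPow 1)
    (iteFn (eqPairFn ∘ fanoutFn (List.tail ∘ nthF 1) (uF ∘ fstF ∘ nthF 0)) (take1Fn ∘ nthF 1) (fun _ => []))
    (sndPow 1)

/-- `scanStep ∈ FP`. [folklore] -/
theorem scanStep_mem_FP : scanStep ∈ FP :=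
  iteFn_mem_FP (comp_mem_FP isNilFn_mem_FP (sndPow_mem_FP 1))
    (iteFn_mem_FP (comp_mem_FP eqPairFn_mem_FP (fanoutFn_mem_FP (comp_mem_FP PRelSigma.tail_mem_FP (nthF_mem_FP 1))
      (comp_mem_FP uF_mem_FP (comp_mem_FP fstF_mem_FP (nthF_mem_FP 0))))) (comp_mem_FP take1Fn_mem_FP (nthF_mem_FP 1)) (const_mem_FP _))
    (sndPow_mem_FP 1)

/-- The model of the scan step. [folklore] -/
def scanModel (u : List Bool) (acc item : List Bool) : List Bool :=
  if acc = [] then (if item.tail = u then item.take 1 else []) else acc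

/-- Value of the scan step on fold records. [folklore] -/
theorem scanStep_apply (v body item acc : List Bool) :
    scanStep (boolPair (boolPair v body) (boolPair item acc)) = scanModel (uF v) acc item := by
  unfold scanStep scanModel
  by_cases hacc : acc = []
  · rw [iteFn_apply_true (by simp [Function.comp_apply, isNilFn, hacc]), if_pos hacc]
    by_cases hit : item.tail = uF v
    · rw [iteFn_apply_true (by simp [Function.comp_apply, eqPairFn_boolPair, hit]), if_pos hit]
      simp [take1Fn]
    · rw [iteFn_apply_false (by simp [Function.comp_apply, eqPairFn_boolPair, hit]), if_neg hit]
  · rw [iteFn_apply_false (by simp [Function.comp_apply, isNilFn, hacc]), if_neg hacc]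
    simp

/-- The scan step has the fold growth bound (constant `1`), on every input. [folklore] -/
theorem foldGrowth_scanStep : FoldGrowth 1 scanStep := by
  intro z
  unfold scanStep
  rw [iteFn_of_oneBit (oneBit_isNilFn.comp _)]
  split_ifs with h1
  · rw [iteFn_of_oneBit (oneBit_eqPairFn.comp _)]
    split_ifs with h2
    · simp only [Function.comp_apply, take1Fn]
      have : (List.take 1 (nthF 1 z)).length ≤ 1 := List.length_take_le _ _
      have h3 : nthF 1 z = fstF (sndF z) := rfl
      omega
    · simp
  · have : sndPow 1 z = sndF (sndF z) := rfl
    rw [this]; omega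

/-- The cache scan: fold the step over the items of the body, from the empty accumulator
(`ListFoldBricks.foldFn`). [cite: AroraBarak2009, §1.3 (bounded loops)] -/
noncomputable def scanF : List Bool → List Bool := foldFn scanStep (fun _ => []) ∘ fanoutFn id bodyF

/-- `scanF ∈ FP`. [folklore] -/
theorem scanF_mem_FP : scanF ∈ FP :=
  comp_mem_FP (foldFn_mem_FP scanStep_mem_FP (const_mem_FP _) foldGrowth_scanStep)
    (fanoutFn_mem_FP (PolyTimeComputable.id _) bodyF_mem_FP)

/-- The model of the scan: the first nonempty item with tail `u`, truncated to its first
symbol (empty if there is none). [folklore] -/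
def firstHit (u : List Bool) (items : List (List Bool)) : List Bool :=
  match items.find? fun e => !e.isEmpty && decide (e.tail = u) with
  | some e => e.take 1
  | none => []

/-- `firstHit` on a nonempty list of items. [folklore] -/
theorem firstHit_cons (u e : List Bool) (items : List (List Bool)) :
    firstHit u (e :: items) = if e ≠ [] ∧ e.tail = u then e.take 1 else firstHit u items := by
  unfold firstHit
  rw [List.find?_cons]
  by_cases h : e ≠ [] ∧ e.tail = u
  · have : (!e.isEmpty && decide (e.tail = u)) = true := by
      cases e with
      | nil => exact absurd rfl h.1
      | cons c e' => simp [h.2]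
    rw [this, if_pos h]
  · have : (!e.isEmpty && decide (e.tail = u)) = false := by
      cases e with
      | nil => simp
      | cons c e' => simp at h ⊢; exact h
    rw [this, if_neg h]

/-- The fold of the scan model computes `firstHit`. [folklore] -/
theorem foldl_scanModel (u : List Bool) : ∀ (items : List (List Bool)) (acc : List Bool),
    items.foldl (scanModel u) acc = if acc = [] then firstHit u items else acc
  | [], acc => by by_cases h : acc = [] <;> simp [firstHit, h]
  | e :: items, acc => by
    rw [List.foldl_cons, foldl_scanModel u items, firstHit_cons]
    by_cases hacc : acc = []
    · subst hacc
      simp only [scanModel, if_true]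
      by_cases he : e.tail = u
      · cases e with
        | nil => simp [he]
        | cons c e' => simp [he]
      · have : ¬ (e ≠ [] ∧ e.tail = u) := fun h => he h.2
        simp [he]
    · simp [scanModel, hacc]

/-- **Value of the scan** on query records. [folklore] -/
theorem scanF_apply (w hdr u : List Bool) (E : List (List Bool)) :
    scanF (boolPair w (boolPair (boolPair hdr (encList E)) u)) = firstHit u E := by
  simp only [scanF, Function.comp_apply, fanoutFn_apply, id, bodyF_apply, foldFn_boolPair,
    decNil_encList]
  have : (fun acc a => scanStep (boolPair (boolPair (boolPair w (boolPair (boolPair hdr (encList E)) u))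
      (encList E)) (boolPair a acc))) = scanModel u := by
    funext acc a; rw [scanStep_apply]; simp
  rw [this, foldl_scanModel, if_pos rfl]

/-- The scan returns at most one symbol, on every input. [folklore] -/
theorem scanF_length (v : List Bool) : (scanF v).length ≤ 1 := by
  simp only [scanF, Function.comp_apply, fanoutFn_apply, id, foldFn_boolPair]
  have key : ∀ (l : List (List Bool)) (acc : List Bool), acc.length ≤ 1 →
      (l.foldl (fun acc a => scanStep (boolPair (boolPair v (bodyF v)) (boolPair a acc))) acc).length ≤ 1 := by
    intro l
    induction l with
    | nil => intro acc h; simpa using h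
    | cons a l ih =>
      intro acc h
      rw [List.foldl_cons]
      refine ih _ ?_
      rw [scanStep_apply, scanModel]
      split_ifs
      · exact List.length_take_le _ _
      · simp
      · exact h
  exact key _ _ (by simp)

/-! ### Cache or coin; the table; the oracle -/

/-- The answer outside the table: the cached answer if any, else the coin. [folklore] -/
noncomputable def cacheCoinF : List Bool → List Bool := iteFn (isNilFn ∘ scanF) coinF scanF

/-- `cacheCoinF ∈ FP`. [folklore] -/
theorem cacheCoinF_mem_FP : cacheCoinF ∈ FP :=
  iteFn_mem_FP (comp_mem_FP isNilFn_mem_FP scanF_mem_FP) coinF_mem_FP scanF_mem_FP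

/-- Value of `cacheCoinF` on query records. [folklore] -/
theorem cacheCoinF_apply (w hdr u : List Bool) (E : List (List Bool)) :
    cacheCoinF (boolPair w (boolPair (boolPair hdr (encList E)) u)) =
      if firstHit u E = [] then [(sndF w).getD hdr.length false] else firstHit u E := by
  unfold cacheCoinF
  by_cases h : firstHit u E = []
  · rw [iteFn_apply_true (by simp [Function.comp_apply, scanF_apply, isNilFn, h]), if_pos h, coinF_apply]
  · rw [iteFn_apply_false (by simp [Function.comp_apply, scanF_apply, isNilFn, h]), if_neg h, scanF_apply]

/-- `cacheCoinF` returns at most one symbol, on every input. [folklore] -/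
theorem cacheCoinF_length (v : List Bool) : (cacheCoinF v).length ≤ 1 := by
  unfold cacheCoinF
  rw [iteFn_of_oneBit (oneBit_isNilFn.comp _)]
  split_ifs
  · exact coinF_length v
  · exact scanF_length v

/-- The hard-wired table as a chain of equality tests against a list of strings. [folklore] -/
noncomputable def tableF (t : List Bool → Bool) : List (List Bool) → List Bool → List Bool
  | [] => cacheCoinF
  | f :: fs => iteFn (eqPairFn ∘ fanoutFn uF (fun _ => f)) (fun _ => [t f]) (tableF t fs)

/-- `tableF t fs ∈ FP`. [folklore] -/
theorem tableF_mem_FP (t : List Bool → Bool) : ∀ fs : List (List Bool), tableF t fs ∈ FP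
  | [] => cacheCoinF_mem_FP
  | _ :: fs => iteFn_mem_FP (comp_mem_FP eqPairFn_mem_FP (fanoutFn_mem_FP uF_mem_FP (const_mem_FP _)))
      (const_mem_FP _) (tableF_mem_FP t fs)

/-- Value of the table chain on query records. [folklore] -/
theorem tableF_apply (t : List Bool → Bool) (w H u : List Bool) : ∀ fs : List (List Bool),
    tableF t fs (boolPair w (boolPair H u)) =
      if u ∈ fs then [t u] else cacheCoinF (boolPair w (boolPair H u))
  | [] => by simp [tableF]
  | f :: fs => by
    rw [tableF]
    by_cases hf : u = f
    · subst hf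
      rw [iteFn_apply_true (by simp [Function.comp_apply, eqPairFn_boolPair]), if_pos (by simp)]
    · rw [iteFn_apply_false (by simp [Function.comp_apply, eqPairFn_boolPair, hf]), tableF_apply t w H u fs]
      by_cases hu : u ∈ fs
      · rw [if_pos hu, if_pos (List.mem_cons_of_mem _ hu)]
      · rw [if_neg hu, if_neg (by simp [hf, hu])]

/-- The table chain returns at most one symbol, on every input. [folklore] -/
theorem tableF_length (t : List Bool → Bool) : ∀ (fs : List (List Bool)) (v : List Bool), (tableF t fs v).length ≤ 1
  | [], v => cacheCoinF_length v
  | f :: fs, v => by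
    rw [tableF, iteFn_of_oneBit (oneBit_eqPairFn.comp _)]
    split_ifs
    · simp
    · exact tableF_length t fs v

/-- The table `τ` as a total function (junk `false` off `F`). [folklore] -/
noncomputable def tabFun (F : Finset (List Bool)) (τ : F → Bool) : List Bool → Bool :=
  fun f => if h : f ∈ F then τ ⟨f, h⟩ else false

/-- **The lazy oracle**: the answer bit followed by the echoed query. [cite: BookVollmerWagner1996, §3 Prop. 1–2 (p. 373–374)] -/
noncomputable def lazyOracle (F : Finset (List Bool)) (τ : F → Bool) : List Bool → List Bool :=
  fun v => tableF (tabFun F τ) F.toList v ++ uF v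

/-- **The lazy oracle is in `FP`.** [cite: AroraBarak2009, §1.3] -/
theorem lazyOracle_mem_FP (F : Finset (List Bool)) (τ : F → Bool) : lazyOracle F τ ∈ FP :=
  append_mem_FP (tableF_mem_FP _ _) uF_mem_FP

/-- The answer bit of the lazy oracle: table, else cache (first earlier item with the same
query), else the coin at position `|E|`. [folklore] -/
noncomputable def lazyBit (F : Finset (List Bool)) (τ : F → Bool) (y : List Bool) (E : List (List Bool))
    (u : List Bool) : Bool :=
  if h : u ∈ F then τ ⟨u, h⟩ else
    if firstHit u E = [] then y.getD E.length false else (firstHit u E).headD false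

/-- **Value of the lazy oracle on query records**: `bit :: u`. [folklore] -/
theorem lazyOracle_apply (F : Finset (List Bool)) (τ : F → Bool) (w u : List Bool) (E : List (List Bool)) :
    lazyOracle F τ (boolPair w (boolPair ((encodingList Bool).listBool.encode E) u)) =
      lazyBit F τ (sndF w) E u :: u := by
  have henc : (encodingList Bool).listBool.encode E = boolPair (unaryEncodeNat E.length) (encList E) := by
    show boolPair _ (E.foldr (fun a acc => boolPair a acc) []) = _
    congr 1
    induction E with
    | nil => rfl
    | cons a E ih => rw [List.foldr_cons, ih, encList_cons]
  rw [lazyOracle, henc, tableF_apply, uF_apply, lazyBit]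
  by_cases hu : u ∈ F
  · rw [if_pos (Finset.mem_toList.2 hu), dif_pos hu, tabFun, dif_pos hu]; rfl
  · rw [if_neg (fun h => hu (Finset.mem_toList.1 h)), dif_neg hu, cacheCoinF_apply]
    have hlen : (unaryEncodeNat E.length).length = E.length := by
      induction E.length with
      | zero => rfl
      | succ n ih => simp [unaryEncodeNat, ih]
    rw [hlen]
    by_cases hh : firstHit u E = []
    · rw [if_pos hh, if_pos hh]; rfl
    · rw [if_neg hh, if_neg hh]
      obtain ⟨c, rest, hc⟩ : ∃ c rest, firstHit u E = c :: rest := by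
        cases hf : firstHit u E with
        | nil => exact absurd hf hh
        | cons c rest => exact ⟨c, rest, rfl⟩
      have hrest : rest = [] := by
        have : (firstHit u E).length ≤ 1 := by
          unfold firstHit; split
          · exact List.length_take_le _ _
          · simp
        rw [hc] at this; simpa using this
      rw [hc, hrest]; rfl

/-- Answers are at most one symbol longer than the query field, on every input. [folklore] -/
theorem length_lazyOracle_le (F : Finset (List Bool)) (τ : F → Bool) (v : List Bool) :
    (lazyOracle F τ v).length ≤ (uF v).length + 1 := by
  simp only [lazyOracle, List.length_append]
  have := tableF_length (tabFun F τ) F.toList v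
  omega

end LazySim



end Literature.Computability.Complexity
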